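import Mathlib.Analysis.SpecialFunctions.Pow.Real
import HarnessLib

/-!
# `GrossTransferStubLinTestPointwiseNumbers` — R8-P8 OF `stub_linTest`'s POINTWISE PACKAGE, PART (N): THE FIVE SMALL TERMS IN NUMBERS
# (LINE 28 «GrossTransfer» v3.2; crux `RevelationMartingale.MeanDeviationL` stmt-QuantumFields-23083 ∕ `UnitScaleTilt.HistoryTailL` stmt-QuantumFields-19936)

Cell `ym3-torus` (YM ladder rung R3 = continuum SU(2) Yang–Mills on T³ — a RUNG, NOT the Clay problem: not d = 4, not infinite volume, not a
mass gap); width seat `ym3-torus-px13` (gen 12), pen on `main_estimate`, helper `--supports stmt-QuantumFields-23083`; part (N) of the ≤ 400-line split.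
PURE REAL ARITHMETIC (Mathlib only; 0 `def`, 0 `sorry`, default heartbeats).

WHAT.  The error term of the pointwise package is `E = 6·E_SD + (3∕2)·E_B + Q + ρ + 3·E_C` (✓`GrossTransferStubLinTestAssembly.sq_le_of_rows`).  With the
size letter `Λ = L^{4j+9}` (which dominates `n`, the collar radii `3R+4+ℓ0` and `(L·L)^j`), the `ℓ¹` masses of parts (I-a)∕(I-b) (`Sa`, the Bianchi mass,
`Sσ`, all `≤ c·(K₀ + 26C₁·s)·M₀` with `s ≤ Λ`, `M₀ ≤ 9Λ`) and P-LOC's remainder `ρ ≤ C_ρ·L^{47j+18}·θ²` (✓`GrossTransferStubLinTestWindows.rem_le`), every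
term is `≤ c·Λ⁴·θ²` or `≤ c·L^{47j+18}θ²`, and `Λ⁴ = L^{16j+36} ≤ L^{47j+18}` (`j ≥ 1`): ★★★`small_terms_le`:
`E ≤ (3244536·(K₀ + 26C₁) + ½ + C_ρ)·L^{47j+18}·θ²` — the input of ✓`GrossTransferStubLinTestAssembly.sq_le_of_window'` (`4·(47j+18) ≤ 260·j ≤ K`).

HONEST SCOPE.  Real arithmetic; proves no stub: `stub_linTest`, its pointwise package, `MeanDeviationL` 23083, `HistoryTailL` 19936, the rung `YM3TorusSU2`
are NOT proved; no summit statement is proved; the Yang–Mills mass gap is NOT proved.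
References: [GrossCMP1983] Thm 2.2 (the bookkeeping of the lattice observables' remainders).
-/

set_option autoImplicit false

namespace Summit.QuantumFields.YangMills.Theorems.GrossTransferStubLinTestPointwiseNumbers

/-- The envelope row: `K₀ + 26·C₁·s ≤ (K₀ + 26·C₁)·Λ` for `s ≤ Λ`, `1 ≤ Λ`, `K₀, C₁ ≥ 0`. [folklore] -/
theorem env_le {K₀ C₁ s Λ : ℝ} (hK₀ : 0 ≤ K₀) (hC₁ : 0 ≤ C₁) (hsΛ : s ≤ Λ) (hΛ1 : 1 ≤ Λ) :
    K₀ + 26 * C₁ * s ≤ (K₀ + 26 * C₁) * Λ := by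
  have h1 : K₀ ≤ K₀ * Λ := by nlinarith only [hK₀, hΛ1]
  nlinarith only [h1, hsΛ, hC₁]

/-- `Λ := L^{4j+9}`: `1 ≤ Λ`, `(L·L)^j ≤ Λ`, `Λ ≤ L^{47j+18}` and `Λ⁴ ≤ L^{47j+18}` (`L ≥ 1`, `j ≥ 1`). [folklore] -/
theorem size_letter {L Λ : ℝ} {j : ℕ} (hL1 : 1 ≤ L) (hj : 1 ≤ j) (hΛ : Λ = L ^ (4 * j + 9)) :
    1 ≤ Λ ∧ (L * L) ^ j ≤ Λ ∧ Λ ≤ L ^ (47 * j + 18) ∧ Λ ^ 4 ≤ L ^ (47 * j + 18) := by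
  refine ⟨?_, ?_, ?_, ?_⟩
  · rw [hΛ]; exact one_le_pow₀ hL1
  · rw [hΛ, ← sq, ← pow_mul]; exact pow_le_pow_right₀ hL1 (by omega)
  · rw [hΛ]; exact pow_le_pow_right₀ hL1 (by omega)
  · rw [hΛ, ← pow_mul]; exact pow_le_pow_right₀ hL1 (by omega)

/-- ★★★ **THE FIVE SMALL TERMS OF R8-P8 IN NUMBERS.**  Letters: `Λ = L^{4j+9}` (`L, j ≥ 1`); `n ≤ Λ`; the collar radii `s₀, s₀' ∈ [0, Λ]`, `s₃, s₃' ≤ Λ`;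
the read-out mass `0 ≤ M ≤ 9Λ`; the kernel constants `K₀, C₁ ≥ 0`; the masses `0 ≤ Sa ≤ (9∕2)(K₀+26C₁s₀)·M`, `BiB = 1312·(2nθ)²·((81∕2)(K₀+26C₁s₀')·M)`,
`0 ≤ Sσ ≤ 6·((9∕2)(K₀+26C₁s₃)·M) + (81∕2)(K₀+26C₁s₃')·M`; the terms `E_SD ≤ 224·n·Sa·θ²`, `E_C = 44·(2nθ)²·Sσ`, `Q ≤ ½(L·L)^jθ²`,
`ρ ≤ C_ρ·L^{47j+18}·θ²`.  Then `6·E_SD + (3∕2)·BiB + Q + ρ + 3·E_C ≤ (3244536·(K₀+26C₁) + ½ + C_ρ)·L^{47j+18}·θ²`. [cite: GrossCMP1983, Thm 2.2] -/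
theorem small_terms_le {L Λ θ K₀ C₁ M Sa Sσ s₀ s₀' s₃ s₃' ESD BiB EC Q ρ Cρ : ℝ} {j n : ℕ}
    (hL1 : 1 ≤ L) (hj : 1 ≤ j) (hΛ : Λ = L ^ (4 * j + 9)) (hnΛ : (n : ℝ) ≤ Λ)
    (hK₀ : 0 ≤ K₀) (hC₁ : 0 ≤ C₁) (hM0 : 0 ≤ M) (hM : M ≤ 9 * Λ)
    (hs₀0 : 0 ≤ s₀) (hs₀ : s₀ ≤ Λ) (hs₀'0 : 0 ≤ s₀') (hs₀' : s₀' ≤ Λ) (hs₃ : s₃ ≤ Λ) (hs₃' : s₃' ≤ Λ)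
    (hSa0 : 0 ≤ Sa) (hSa : Sa ≤ (9 / 2) * (K₀ + 26 * C₁ * s₀) * M)
    (hBiB : BiB = 1312 * (2 * (n : ℝ) * θ) ^ 2 * ((81 / 2) * (K₀ + 26 * C₁ * s₀') * M))
    (hSσ0 : 0 ≤ Sσ) (hSσ : Sσ ≤ 6 * ((9 / 2) * (K₀ + 26 * C₁ * s₃) * M) + (81 / 2) * (K₀ + 26 * C₁ * s₃') * M)
    (hESD : ESD ≤ 224 * (n : ℝ) * Sa * θ ^ 2) (hEC : EC = 44 * (2 * (n : ℝ) * θ) ^ 2 * Sσ)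
    (hQ : Q ≤ (1 / 2) * (L * L) ^ j * θ ^ 2) (hρ : ρ ≤ Cρ * L ^ (47 * j + 18) * θ ^ 2) :
    6 * ESD + 3 / 2 * BiB + Q + ρ + 3 * EC ≤ (3244536 * (K₀ + 26 * C₁) + 1 / 2 + Cρ) * L ^ (47 * j + 18) * θ ^ 2 := by
  obtain ⟨hΛ1, hLLj, hΛ47, hΛ4⟩ := size_letter hL1 hj hΛ
  have hΛ0 : 0 ≤ Λ := zero_le_one.trans hΛ1
  have hθsq0 : 0 ≤ θ ^ 2 := sq_nonneg θ
  have hKC : 0 ≤ K₀ + 26 * C₁ := by positivity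
  have hn0 : (0 : ℝ) ≤ n := Nat.cast_nonneg n
  have hn2 : (n : ℝ) ^ 2 ≤ Λ ^ 2 := pow_le_pow_left₀ hn0 hnΛ 2
  -- `Sa ≤ (81/2)(K₀+26C₁)·Λ²`
  have hSaΛ : Sa ≤ (81 / 2) * (K₀ + 26 * C₁) * Λ ^ 2 := by
    have h1 := env_le hK₀ hC₁ hs₀ hΛ1
    have h0a : 0 ≤ K₀ + 26 * C₁ * s₀ := by positivity
    calc Sa ≤ (9 / 2) * (K₀ + 26 * C₁ * s₀) * M := hSa
      _ ≤ (9 / 2) * ((K₀ + 26 * C₁) * Λ) * (9 * Λ) := mul_le_mul (mul_le_mul_of_nonneg_left h1 (by norm_num)) hM hM0 (by positivity)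
      _ = (81 / 2) * (K₀ + 26 * C₁) * Λ ^ 2 := by ring
  -- `E_SD ≤ 9072(K₀+26C₁)·Λ⁴·θ²`
  have hE5Λ : ESD ≤ 9072 * (K₀ + 26 * C₁) * Λ ^ 4 * θ ^ 2 := by
    have h1 : (n : ℝ) * Sa ≤ Λ * ((81 / 2) * (K₀ + 26 * C₁) * Λ ^ 2) := mul_le_mul hnΛ hSaΛ hSa0 hΛ0
    have h2 : Λ * ((81 / 2) * (K₀ + 26 * C₁) * Λ ^ 2) ≤ (81 / 2) * (K₀ + 26 * C₁) * Λ ^ 4 := by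
      have : Λ ^ 3 ≤ Λ ^ 4 := pow_le_pow_right₀ hΛ1 (by norm_num)
      nlinarith only [this, hKC]
    nlinarith only [hESD, h1, h2, hθsq0, hn0, hSa0]
  -- `BiB ≤ 1912896(K₀+26C₁)·Λ⁴·θ²`
  have hBiBΛ : BiB ≤ 1912896 * (K₀ + 26 * C₁) * Λ ^ 4 * θ ^ 2 := by
    have h1 := env_le hK₀ hC₁ hs₀' hΛ1
    have h2 : (81 / 2) * (K₀ + 26 * C₁ * s₀') * M ≤ (81 / 2) * ((K₀ + 26 * C₁) * Λ) * (9 * Λ) :=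
      mul_le_mul (mul_le_mul_of_nonneg_left h1 (by norm_num)) hM hM0 (by positivity)
    have h3 : 4 * (n : ℝ) ^ 2 * θ ^ 2 ≤ 4 * Λ ^ 2 * θ ^ 2 := by nlinarith only [hn2, hθsq0]
    have h20 : 0 ≤ (81 / 2) * (K₀ + 26 * C₁ * s₀') * M := by positivity
    rw [hBiB, show (2 * (n : ℝ) * θ) ^ 2 = 4 * (n : ℝ) ^ 2 * θ ^ 2 by ring]
    calc 1312 * (4 * (n : ℝ) ^ 2 * θ ^ 2) * ((81 / 2) * (K₀ + 26 * C₁ * s₀') * M)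
        ≤ 1312 * (4 * Λ ^ 2 * θ ^ 2) * ((81 / 2) * ((K₀ + 26 * C₁) * Λ) * (9 * Λ)) :=
          mul_le_mul (mul_le_mul_of_nonneg_left h3 (by norm_num)) h2 h20 (by positivity)
      _ = 1912896 * (K₀ + 26 * C₁) * Λ ^ 4 * θ ^ 2 := by ring
  -- `E_C ≤ 106920(K₀+26C₁)·Λ⁴·θ²`
  have hSσΛ : Sσ ≤ (1215 / 2) * (K₀ + 26 * C₁) * Λ ^ 2 := by
    have h1 := env_le hK₀ hC₁ hs₃ hΛ1
    have h2 := env_le hK₀ hC₁ hs₃' hΛ1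
    have t1 : (K₀ + 26 * C₁ * s₃) * M ≤ ((K₀ + 26 * C₁) * Λ) * (9 * Λ) := mul_le_mul h1 hM hM0 (by positivity)
    have t2 : (K₀ + 26 * C₁ * s₃') * M ≤ ((K₀ + 26 * C₁) * Λ) * (9 * Λ) := mul_le_mul h2 hM hM0 (by positivity)
    nlinarith only [hSσ, t1, t2]
  have hECΛ : EC ≤ 106920 * (K₀ + 26 * C₁) * Λ ^ 4 * θ ^ 2 := by
    have h3 : 4 * (n : ℝ) ^ 2 * θ ^ 2 ≤ 4 * Λ ^ 2 * θ ^ 2 := by nlinarith only [hn2, hθsq0]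
    rw [hEC, show (2 * (n : ℝ) * θ) ^ 2 = 4 * (n : ℝ) ^ 2 * θ ^ 2 by ring]
    calc 44 * (4 * (n : ℝ) ^ 2 * θ ^ 2) * Sσ ≤ 44 * (4 * Λ ^ 2 * θ ^ 2) * ((1215 / 2) * (K₀ + 26 * C₁) * Λ ^ 2) :=
          mul_le_mul (mul_le_mul_of_nonneg_left h3 (by norm_num)) hSσΛ hSσ0 (by positivity)
      _ = 106920 * (K₀ + 26 * C₁) * Λ ^ 4 * θ ^ 2 := by ring
  -- `Q ≤ ½·Λ⁴·θ²`
  have hQΛ : Q ≤ (1 / 2) * Λ ^ 4 * θ ^ 2 := by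
    have h1 : Λ ≤ Λ ^ 4 := by
      calc Λ = Λ ^ 1 := (pow_one Λ).symm
        _ ≤ Λ ^ 4 := pow_le_pow_right₀ hΛ1 (by norm_num)
    nlinarith only [hQ, hLLj, h1, hθsq0]
  -- sum
  have hΛ4θ : Λ ^ 4 * θ ^ 2 ≤ L ^ (47 * j + 18) * θ ^ 2 := mul_le_mul_of_nonneg_right hΛ4 hθsq0
  have hP0 : 0 ≤ L ^ (47 * j + 18) * θ ^ 2 := mul_nonneg (pow_nonneg (zero_le_one.trans hL1) _) hθsq0
  nlinarith only [hE5Λ, hBiBΛ, hECΛ, hQΛ, hρ, hΛ4θ, hP0, hKC]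

/-- **THE COLLAR BOX FITS THE TORUS** in the window `60·j ≤ K`: with `R₀ ≤ (7L+2)·L^j` and `R = (R₀+12)·L^{3j}`, `12R + 18 ≤ 2·L^{m+K}` (`L ≥ 2`, `j ≥ 1`).
[cite: Balaban1985UV3, (1)-(3) p.256] -/
theorem box_fits {L m K j R₀ : ℕ} (hL : 2 ≤ L) (hj : 1 ≤ j) (hK : 60 * j ≤ K) (hR₀ : R₀ ≤ (7 * L + 2) * L ^ j) :
    12 * ((R₀ + 12) * L ^ (3 * j)) + 18 ≤ 2 * L ^ (m + K) := by
  have hL1 : 1 ≤ L := le_trans (by norm_num) hL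
  have hLj : 1 ≤ L ^ j := Nat.one_le_pow _ _ hL1
  have hL4j : 1 ≤ L ^ (4 * j) := Nat.one_le_pow _ _ hL1
  have h1 : R₀ + 12 ≤ (7 * L + 14) * L ^ j := by nlinarith
  have h2 : 12 * ((R₀ + 12) * L ^ (3 * j)) + 18 ≤ (84 * L + 186) * L ^ (4 * j) := by
    have e : L ^ (4 * j) = L ^ j * L ^ (3 * j) := by rw [← pow_add]; congr 1; ring
    rw [e]
    nlinarith [Nat.zero_le (L ^ (3 * j)), Nat.zero_le (L ^ j)]
  have h3 : 84 * L + 186 ≤ L ^ 9 := by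
    have h8 : 256 ≤ L ^ 8 := by
      calc 256 = 2 ^ 8 := by norm_num
        _ ≤ L ^ 8 := Nat.pow_le_pow_left hL 8
    have : 84 * L + 186 ≤ 177 * L := by omega
    calc 84 * L + 186 ≤ 177 * L := this
      _ ≤ L ^ 8 * L := by nlinarith
      _ = L ^ 9 := by ring
  have h4 : (84 * L + 186) * L ^ (4 * j) ≤ L ^ (m + K) := by
    calc (84 * L + 186) * L ^ (4 * j) ≤ L ^ 9 * L ^ (4 * j) := Nat.mul_le_mul_right _ h3
      _ = L ^ (9 + 4 * j) := by rw [← pow_add]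
      _ ≤ L ^ (m + K) := Nat.pow_le_pow_right hL1 (by omega)
  omega

end Summit.QuantumFields.YangMills.Theorems.GrossTransferStubLinTestPointwiseNumbers
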